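import Summits.AnomalousDissipation.AnomalousDissipation.Theorems.SawtoothPulseCascadeK1LocalisedCascadeAxisKernel

/-!
# K1loc, line `Spectral` / thin start — helper: GEOMETRIC SUMS AND THE FEJÉR KERNEL ON THE CIRCLE (explicit kernel bounds)

Helper file of the prover lane on the crux `K1LocalisedCascade` (stmt-AnomalousDissipation-19491), route
`SawtoothPulseCascade` (S-D fibre ledger; the constants lever of memo v9 §9: kernels of plateau symbols through Fejér kernels,
so that `‖k‖₁` and the tails are paid by the FIRST moment of the kernel, not by Cauchy–Schwarz).
* `norm_geom_sum_le` — `‖Σ_{m<n} e_{−m}(s)‖ ≤ 1/(2‖s‖)` (`(e_{−1} − 1)·Σ = e_{−n} − 1`, `4‖s‖ ≤ |e₁ − 1|`);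
* `fejer_identity` — `Σ_{|l|<n} (n − |l|)·e_l(s) = ‖Σ_{m<n} e_{−m}(s)‖²` (induction on `n`);
* `fejer_nonneg`, `fejer_le_inv_sq` (`F_n(s) = (1/n)‖Σ_{m<n}e_{−m}‖² ≤ 1/(4n‖s‖²)`), `integral_fejer` (`∫ F_n = 1`).
No definitions (the kernels are written out); no statement about the crux. [cite: Grafakos2014, §3.1.3 (Fejér kernel)] [problem: turb]
-/

-- `Summit.<Summit>.<Problem>`: single-conjunct summit, the duplicate namespace segment is deliberate.
set_option linter.dupNamespace false

noncomputable section

namespace Summit.AnomalousDissipation.AnomalousDissipation.Theorems.SawtoothPulseCascade.K1Window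

open MeasureTheory Set Filter Topology Function Complex
open scoped Real

/-! ## §1 Geometric sums of characters -/

/-- Telescoping: `(e_{−1}(s) − 1)·Σ_{m<n} e_{−m}(s) = e_{−n}(s) − 1`. [folklore] -/
theorem fourier_neg_one_sub_one_mul_geom_sum (n : ℕ) (s : UnitAddCircle) :
    ((fourier (-1) s : ℂ) - 1) * ∑ m ∈ Finset.range n, (fourier (-(m : ℤ)) s : ℂ) = fourier (-(n : ℤ)) s - 1 := by
  induction n with
  | zero => simp
  | succ n ih =>
    rw [Finset.sum_range_succ, mul_add, ih]
    have h : (fourier (-1) s : ℂ) * fourier (-(n : ℤ)) s = fourier (-((n + 1 : ℕ) : ℤ)) s := by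
      rw [← fourier_add]; congr 1; push_cast; ring
    rw [sub_mul, one_mul, h]; ring

/-- **Geometric sum bound**: `‖Σ_{m<n} e_{−m}(s)‖ ≤ 1/(2‖s‖)` for `s ≠ 0`. [cite: Grafakos2014, §3.1.3] -/
theorem norm_geom_sum_le (n : ℕ) {s : UnitAddCircle} (hs : 0 < ‖s‖) :
    ‖∑ m ∈ Finset.range n, (fourier (-(m : ℤ)) s : ℂ)‖ ≤ 1 / (2 * ‖s‖) := by
  have h4 := four_mul_norm_le_norm_fourier_one_sub_one s
  -- `‖e_{−1} − 1‖ = ‖e₁ − 1‖`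
  have hconj : ‖(fourier (-1) s : ℂ) - 1‖ = ‖(fourier 1 s : ℂ) - 1‖ := by
    have e : (fourier (-1) s : ℂ) - 1 = starRingEnd ℂ ((fourier 1 s : ℂ) - 1) := by
      rw [map_sub, map_one, ← fourier_neg]
    rw [e, Complex.norm_conj]
  have hpos : 0 < ‖(fourier (-1) s : ℂ) - 1‖ := by rw [hconj]; linarith
  have hid := fourier_neg_one_sub_one_mul_geom_sum n s
  have hnorm : ‖(fourier (-1) s : ℂ) - 1‖ * ‖∑ m ∈ Finset.range n, (fourier (-(m : ℤ)) s : ℂ)‖ ≤ 2 := by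
    rw [← norm_mul, hid]
    refine (norm_sub_le _ _).trans ?_
    have : ‖(fourier (-(n : ℤ)) s : ℂ)‖ = 1 := Circle.norm_coe _
    rw [this, norm_one]; norm_num
  rw [le_div_iff₀ (by positivity)]
  calc ‖∑ m ∈ Finset.range n, (fourier (-(m : ℤ)) s : ℂ)‖ * (2 * ‖s‖)
      = (4 * ‖s‖) * ‖∑ m ∈ Finset.range n, (fourier (-(m : ℤ)) s : ℂ)‖ / 2 := by ring
    _ ≤ ‖(fourier (-1) s : ℂ) - 1‖ * ‖∑ m ∈ Finset.range n, (fourier (-(m : ℤ)) s : ℂ)‖ / 2 := by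
        rw [hconj] at hpos ⊢
        exact div_le_div_of_nonneg_right (mul_le_mul_of_nonneg_right h4 (norm_nonneg _)) (by norm_num)
    _ ≤ 1 := by linarith

/-! ## §2 The Fejér identity -/

/-- **Fejér identity**: `Σ_{l=-(n-1)}^{n-1} (n − |l|)·e_l(s) = ‖Σ_{m<n} e_{−m}(s)‖²`. [cite: Grafakos2014, §3.1.3] -/
theorem fejer_identity (n : ℕ) (s : UnitAddCircle) :
    ∑ l ∈ Finset.Icc (-(n : ℤ)) n, (((n : ℝ) - |(l : ℝ)|) : ℂ) * fourier l s =
      ((‖∑ m ∈ Finset.range n, (fourier (-(m : ℤ)) s : ℂ)‖ ^ 2 : ℝ) : ℂ) := by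
  induction n with
  | zero => simp
  | succ n ih =>
    -- the right side: `‖S + e_{-n}‖² = ‖S‖² + 1 + (e_{-n}·conj S + conj(e_{-n})·S)`
    set S : ℂ := ∑ m ∈ Finset.range n, (fourier (-(m : ℤ)) s : ℂ) with hS
    have hsq : ∀ z : ℂ, ((‖z‖ ^ 2 : ℝ) : ℂ) = starRingEnd ℂ z * z := fun z => by
      rw [Complex.ofReal_pow]; exact (RCLike.conj_mul z).symm
    rw [Finset.sum_range_succ, ← hS, hsq, map_add, add_mul, mul_add, mul_add, ← hsq S]
    have hen : starRingEnd ℂ (fourier (-(n : ℤ)) s : ℂ) = fourier (n : ℤ) s := by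
      rw [← fourier_neg, neg_neg]
    rw [hen]
    have hee : (fourier (n : ℤ) s : ℂ) * fourier (-(n : ℤ)) s = 1 := by
      rw [← fourier_add]; simp
    -- `conj S * e_{-n} = Σ_{m<n} e_{m-n}`, `e_n * S = Σ_{m<n} e_{n-m}`
    have hcS : starRingEnd ℂ S = ∑ m ∈ Finset.range n, (fourier (m : ℤ) s : ℂ) := by
      rw [hS, map_sum]; refine Finset.sum_congr rfl fun m _ => ?_; rw [← fourier_neg, neg_neg]
    rw [hcS, hee, ← ih]
    -- now a pure identity between finite character sums
    have h1 : (∑ m ∈ Finset.range n, (fourier (m : ℤ) s : ℂ)) * fourier (-(n : ℤ)) s =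
        ∑ m ∈ Finset.range n, (fourier ((m : ℤ) - n) s : ℂ) := by
      rw [Finset.sum_mul]; refine Finset.sum_congr rfl fun m _ => ?_
      rw [← fourier_add]; congr 1
    have h2 : (fourier (n : ℤ) s : ℂ) * S = ∑ m ∈ Finset.range n, (fourier ((n : ℤ) - m) s : ℂ) := by
      rw [hS, Finset.mul_sum]; refine Finset.sum_congr rfl fun m _ => ?_
      rw [← fourier_add]; congr 1
    rw [h1, h2]
    -- compare coefficients: LHS(n+1) = LHS(n) + Σ_{|l| ≤ n} e_l
    have key : ∑ l ∈ Finset.Icc (-((n + 1 : ℕ) : ℤ)) (n + 1 : ℕ), ((((n + 1 : ℕ) : ℝ) - |(l : ℝ)|) : ℂ) * fourier l s =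
        (∑ l ∈ Finset.Icc (-(n : ℤ)) n, (((n : ℝ) - |(l : ℝ)|) : ℂ) * fourier l s) +
          ∑ l ∈ Finset.Icc (-(n : ℤ)) n, (fourier l s : ℂ) := by
      have hsub : Finset.Icc (-(n : ℤ)) n ⊆ Finset.Icc (-((n + 1 : ℕ) : ℤ)) (n + 1 : ℕ) :=
        Finset.Icc_subset_Icc (by push_cast; omega) (by push_cast; omega)
      rw [← Finset.sum_add_distrib]
      rw [← Finset.sum_subset hsub (fun l hl hl' => ?_)]
      · refine Finset.sum_congr rfl fun l _ => ?_
        push_cast; ring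
      · -- the two new endpoints `l = ±(n+1)` have coefficient `0`
        have : |(l : ℝ)| = n + 1 := by
          rw [Finset.mem_Icc] at hl hl'
          push_cast at hl
          have : l = (n : ℤ) + 1 ∨ l = -((n : ℤ) + 1) := by omega
          rcases this with rfl | rfl
          · push_cast; rw [abs_of_nonneg (by positivity)]
          · push_cast; rw [abs_neg, abs_of_nonneg (by positivity)]
        rw [this]; push_cast; ring
    rw [key]
    -- and Σ_{|l| ≤ n} e_l = 1 + Σ_{m<n} e_{m-n} + Σ_{m<n} e_{n-m}
    have hsplit : ∑ l ∈ Finset.Icc (-(n : ℤ)) n, (fourier l s : ℂ) =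
        (∑ m ∈ Finset.range n, (fourier ((m : ℤ) - n) s : ℂ)) + 1 + ∑ m ∈ Finset.range n, (fourier ((n : ℤ) - m) s : ℂ) := by
      -- split `[-n, n] = [-n, -1] ∪ {0} ∪ [1, n]` and reindex
      have hIcc : Finset.Icc (-(n : ℤ)) n = Finset.Icc (-(n : ℤ)) (-1) ∪ {0} ∪ Finset.Icc 1 (n : ℤ) := by
        ext l; simp only [Finset.mem_union, Finset.mem_Icc, Finset.mem_singleton]; omega
      have hd1 : Disjoint (Finset.Icc (-(n : ℤ)) (-1) ∪ {0}) (Finset.Icc 1 (n : ℤ)) := by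
        rw [Finset.disjoint_left]; intro l hl hl'
        simp only [Finset.mem_union, Finset.mem_Icc, Finset.mem_singleton] at hl hl'; omega
      have hd2 : Disjoint (Finset.Icc (-(n : ℤ)) (-1)) {0} := by
        rw [Finset.disjoint_left]; intro l hl hl'
        simp only [Finset.mem_Icc, Finset.mem_singleton] at hl hl'; omega
      rw [hIcc, Finset.sum_union hd1, Finset.sum_union hd2, Finset.sum_singleton, fourier_zero]
      have hinj1 : Set.InjOn (fun m : ℕ => (m : ℤ) - n) (Finset.range n : Set ℕ) := by
        intro a _ b _ h; have : (a : ℤ) = b := by simpa using h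
        exact_mod_cast this
      have hinj2 : Set.InjOn (fun m : ℕ => (n : ℤ) - m) (Finset.range n : Set ℕ) := by
        intro a _ b _ h; have : (a : ℤ) = b := by have := h; simp only at this; omega
        exact_mod_cast this
      have him1 : (Finset.range n).image (fun m : ℕ => (m : ℤ) - n) = Finset.Icc (-(n : ℤ)) (-1) := by
        ext l
        simp only [Finset.mem_image, Finset.mem_range, Finset.mem_Icc]
        constructor
        · rintro ⟨m, hm, rfl⟩; omega
        · intro hl; exact ⟨(l + n).toNat, by omega, by omega⟩
      have him2 : (Finset.range n).image (fun m : ℕ => (n : ℤ) - m) = Finset.Icc 1 (n : ℤ) := by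
        ext l
        simp only [Finset.mem_image, Finset.mem_range, Finset.mem_Icc]
        constructor
        · rintro ⟨m, hm, rfl⟩; omega
        · intro hl; exact ⟨((n : ℤ) - l).toNat, by omega, by omega⟩
      rw [← him1, ← him2, Finset.sum_image hinj1, Finset.sum_image hinj2]
    rw [hsplit]
    push_cast
    ring


/-! ## §3 The Fejér kernel: nonnegative, bounded by `1/(4‖s‖²)`, unit mass -/

/-- The Fejér sum is the real number `‖Σ_{m<n} e_{−m}(s)‖² ≥ 0`, and `≤ 1/(4‖s‖²)` off `s = 0`. [cite: Grafakos2014, §3.1.3] -/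
theorem fejer_le_inv_sq (n : ℕ) {s : UnitAddCircle} (hs : 0 < ‖s‖) :
    ‖∑ m ∈ Finset.range n, (fourier (-(m : ℤ)) s : ℂ)‖ ^ 2 ≤ 1 / (4 * ‖s‖ ^ 2) := by
  have h := norm_geom_sum_le n hs
  have h0 := norm_nonneg (∑ m ∈ Finset.range n, (fourier (-(m : ℤ)) s : ℂ))
  calc ‖∑ m ∈ Finset.range n, (fourier (-(m : ℤ)) s : ℂ)‖ ^ 2 ≤ (1 / (2 * ‖s‖)) ^ 2 := pow_le_pow_left₀ h0 h 2
    _ = 1 / (4 * ‖s‖ ^ 2) := by field_simp; ring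

/-- Crude bound: `‖Σ_{m<n} e_{−m}(s)‖² ≤ n²`. [folklore] -/
theorem fejer_le_sq (n : ℕ) (s : UnitAddCircle) :
    ‖∑ m ∈ Finset.range n, (fourier (-(m : ℤ)) s : ℂ)‖ ^ 2 ≤ (n : ℝ) ^ 2 := by
  have h : ‖∑ m ∈ Finset.range n, (fourier (-(m : ℤ)) s : ℂ)‖ ≤ n := by
    refine (norm_sum_le _ _).trans ?_
    have : ∀ m ∈ Finset.range n, ‖(fourier (-(m : ℤ)) s : ℂ)‖ = 1 := fun m _ => Circle.norm_coe _
    rw [Finset.sum_congr rfl this, Finset.sum_const, Finset.card_range]; simp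
  exact pow_le_pow_left₀ (norm_nonneg _) h 2

/-- **Unit mass of the Fejér kernel**: `∫_T ‖Σ_{m<n} e_{−m}(s)‖² ds = n`. [cite: Grafakos2014, §3.1.3] -/
theorem integral_fejer (n : ℕ) :
    ∫ s : UnitAddCircle, ‖∑ m ∈ Finset.range n, (fourier (-(m : ℤ)) s : ℂ)‖ ^ 2 = n := by
  classical
  have hinj : Set.InjOn (fun m : ℕ => (m : ℤ)) (Finset.range n : Set ℕ) := fun a _ b _ h => by
    have h' : (a : ℤ) = b := h
    exact_mod_cast h'
  have hsum : ∀ s : UnitAddCircle, ∑ m ∈ Finset.range n, (fourier (-(m : ℤ)) s : ℂ) =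
      ∑ l ∈ (Finset.range n).image (fun m : ℕ => (m : ℤ)), (1 : ℤ → ℂ) l * fourier (-l) s := by
    intro s
    rw [Finset.sum_image hinj]
    simp
  simp_rw [hsum, integral_norm_sq_trigPoly]
  simp [Finset.card_image_of_injOn hinj]

/-- The continuity of the Fejér kernel. [folklore] -/
theorem continuous_fejer (n : ℕ) :
    Continuous fun s : UnitAddCircle => ‖∑ m ∈ Finset.range n, (fourier (-(m : ℤ)) s : ℂ)‖ ^ 2 := by
  have h : Continuous fun s : UnitAddCircle => ∑ m ∈ Finset.range n, (fourier (-(m : ℤ)) s : ℂ) :=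
    continuous_finsetSum _ fun m _ => (fourier (-(m : ℤ))).continuous
  exact (continuous_norm.comp h).pow 2

end Summit.AnomalousDissipation.AnomalousDissipation.Theorems.SawtoothPulseCascade.K1Window
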